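/-
Copyright (c) 2026 the pub-hodgecm-mathlib formalisation cell (harness21).  Prover seat hodgecm-mathlib-K2E4-p10 (g10), Track B «K2-LIT»,
#184♮ = hLiu418 = `stmt-HodgeConjecture-24832`; socket #41, KIND 1 — (K1a-dec) THE (dec) LETTER OF THE SINGULAR-TERM PACKAGE ★ p863404 §2 FROM PER-FACTOR BOUNDS
(line lead K2E5-p16 (g8) WORD #10 (2), 2026-09-05T00:05:44Z).  THEOREMS ONLY (no `def`, no `instance`, no notation, no named-fact hypothesis, no `sorry`).
-/
import Summits.HodgeConjecture.HodgeConjecture.Theorems.K2LiuKindOneSingularTermPackage           -- ★ p863404 (this seat): the package §2 whose `hdec` binder this file pays (frame vocabulary)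
import Summits.HodgeConjecture.HodgeConjecture.Theorems.K2LiuSiegelEisensteinKindWLocalExponents  -- ★ p863033 (this lineage, g9): `one_add_pow_mul_exp_neg_le` (absorption into the Gaussian); ⊇ ★ G7-C `exists_adelicHeightGL_floor`
import HarnessLib

/-!
# Crux `HLiu418`, socket #41, KIND 1 — (K1a-dec) `K2LiuKindOneSingularDecayOfLetters`: THE HEIGHT-FORM GAUSSIAN DECAY LETTER `hdec` OF ★ p863404 §2
# FOR THE EXPLICIT RANK-ONE EXPRESSION, FROM PER-FACTOR BOUNDS (polynomial exponents local in `z`, absorbed into the Gaussian)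

Cell `hodgecm-mathlib`, crux item hLiu418 = `stmt-HodgeConjecture-24832` (helper lane `--supports … --as helper`, count-neutral), route of record `HCCMUnconditional`;
squad K2 ∕ K2Liu, road `K2_Liu`, socket #41, KIND 1 a♮; line lead K2E5-p16 (g8).  ★ p863404 `K2LiuKindOneSingularTermPackage.exists_kindOne_singularTermPackage_of_placeLetters`
(§2) takes BY VALUE the (dec) letter `τa hτa Na hdec` about the EXPLICIT rank-one expression
  `X S s h = c S h · (Σ_{i∈I S h} Ac S i s h · ∏_{v∈T S h} Gn S i v s h) · ((∏_{v∈Pm S h} c¹_v(s)⁻¹) · G s) · ∏_{v∈D S h} P S h v s`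
in the TOP's shape `‖X S s h‖ ≤ C·H(h)^a·(e^{−b·H(h)^{−a′}·τa S}·(1 + τa S)^{Na})` near every `z ∈ {0 < re}`, with a GLOBAL polynomial exponent `Na`.  THIS FILE pays it from
ONE BOUND PER FACTOR, each in its payer's natural currency (rank-one guard `↑S ≠ 0 → det ↑S = 0 →` inside; the four analytic ones LOCAL near `z` WITH THEIR POLYNOMIAL EXPONENT
INSIDE the `∃` — the `|σ|^{re s₁}`-type prefactors of the twisted archimedean ∕ local factors have `z`-dependent degree):
* (L0) the constant: `‖c S h‖ ≤ Cc·H(h)^{ac}·(1 + τa S)^{Nc}` (global; (K1a-T) K2Liu-p03 ∕ the corner transport's normalisation);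
* (L1) the tensor count: `#(I S h) ≤ NI` (global; a `K`-finite standard section is a fixed finite sum of pure tensors);
* (L2) the ARCHIMEDEAN factor per pure tensor: `‖Ac S i s h‖ ≤ C·H^a·(e^{−b H^{−a′} τa S}·(1 + τa S)^{N₁})` — the Gaussian lives here ((Φ-S1) R90-C131-p02 ∕ LH4-p11, (K1a-3-arch) ★ p862699);
* (L3) the FINITE head per pure tensor: `‖∏_{v∈T S h} Gn S i v s h‖ ≤ C·H^a·(1 + τa S)^{N₂}` (localFace LH4-p07 ∕ K2E3-p37 ∕ LH4-p10);
* (L4) the TRANSPORTED SCALAR: `‖(∏_{v∈Pm S h} c¹_v(s)⁻¹)·G s‖ ≤ C·H^a·(1 + τa S)^{N₃}` (★ p863157 `norm_transportedG_le`: `(16∕3)^{#Pm}·‖G s‖`, `#Pm S h ≤ ω(σ♭)`);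
* (L5) the SHELL POLYNOMIALS: `‖∏_{v∈D S h} P S h v s‖ ≤ C·H^a·(1 + τa S)^{N₄}` (divisor count of `σ♭`, ★ p863366's `m v`).
OUTPUT **`hdec_of_factorBounds`**: `∃ Na, ‹★ p863404 §2's `hdec` binder BYTES›` (consumer: `obtain ⟨Na, hdec⟩ := hdec_of_factorBounds …`, then `τa hτa Na hdec` into §2).  Proof, per `z`:
the four local packages at `z`, `r := min`, `‖X‖ ≤ ‖c‖·(Σ_i ‖Ac_i‖·‖∏Gn_i‖)·‖(∏c¹⁻¹)·G‖·‖∏P‖` (`norm_mul`, `norm_sum_le`, `Finset.sum_const`), the powers of `H` and of `(1+τ)`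
collected (`Real.rpow_add` at `0 < H(h)` — Lit `adelicHeightGL_pos_holds` —, `ring`), then the ABSORPTION ★ `one_add_pow_mul_exp_neg_le` with the height floor ★
`exists_adelicHeightGL_floor`: `e^{−bH^{−a′}τ}(1+τ)^M ≤ K·H^{a′M}·e^{−(b∕2)H^{−a′}τ}` ⇒ `C ↦ Cc·NI·C₁·C₂·C₃·C₄·K`, `a ↦ ac+a₁+a₂+a₃+a₄+a′M`, `b ↦ b∕2`, `Na := 0`
(the TOP's `N_W := 0` move of ★ `hdec_of_letters_local`).  `n = 2` is read off `e` only to know `n + n ≠ 0` (the height's positivity and floor).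
[MoeglinWaldspurger1995, II.1.7, IV.1.9], [Shimura1982, §3], [Shimura1997, §18.4 Prop. 18.14], [BorelJacquet1979, §1.2], [Tan1999, §4 Prop. 4.8].
HONEST LABEL.  Elementary-estimate bookkeeping, count-neutral, hypothesis-first on the five factor letters; it closes no socket: `HC_CM` is proved only modulo the 7 printed
citations (2 remaining named inputs: hLiu418 = `stmt-HodgeConjecture-24832`, h413 = `stmt-HodgeConjecture-24833`) until rung 0 closes.

## References
* [MoeglinWaldspurger1995] C. Mœglin, J.-L. Waldspurger (1995): II.1.7, IV.1.9.   * [Shimura1982] G. Shimura, Math. Ann. 260 (1982): §3.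
* [Shimura1997] G. Shimura, CBMS 93 (1997): §18.4 Prop. 18.14.   * [BorelJacquet1979] A. Borel, H. Jacquet, Corvallis I (1979): §1.2.   * [Tan1999] V. Tan, Canad. J. Math. 51 (1999): §4 Prop. 4.8.
-/

set_option autoImplicit false
-- the mandated namespace repeats the single-problem summit's segment (`HodgeConjecture.HodgeConjecture`)
set_option linter.dupNamespace false

noncomputable section

open scoped Matrix ENNReal NNReal Topology ComplexConjugate
open NumberField IsDedekindDomain MeasureTheory MeasureTheory.Measure Filter Set Function Metric
open Literature.NumberTheory.Automorphic Literature.NumberTheory.Automorphic.UnitaryGroup Literature.NumberTheory.GaloisRepresentations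
open Literature.NumberTheory.LFunctions
open Literature.NumberTheory.GelbartRogawski1991 Literature.NumberTheory.GelbartRogawski1991.GRConstruction
open Literature.NumberTheory.K2Lit.SiegelDoubled Literature.MeasureTheory.Group
open Literature.NumberTheory.Automorphic.IdeleClassGroup

namespace Summit.HodgeConjecture.HodgeConjecture.Cruxes.HLiu418.K2LiuKindOneSingularDecayOfLetters

open K2LiuSiegelUnipotentFourierDefs K2LiuSiegelUnipotentCharacters K2LiuUnipotentCoveringWeight K2LiuSiegelFourierCoeffDelta
open K2LiuSiegelEisensteinKindWLocalExponents (one_add_pow_mul_exp_neg_le)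
open K2LiuIwasawaHeightLatticeSumBound (exists_adelicHeightGL_floor)

open Classical in
/-- **(K1a-dec) THE (dec) LETTER OF ★ p863404 §2 FROM PER-FACTOR BOUNDS.**  For the explicit rank-one expression
`X S s h = c S h · (Σ_{i∈I S h} Ac S i s h · ∏_{v∈T S h} Gn S i v s h) · ((∏_{v∈Pm S h} c¹_v(s)⁻¹) · G s) · ∏_{v∈D S h} P S h v s` and a size `τa ≥ ‖ι_∞ S‖`: from (L0) a global bound on
the constant `‖c S h‖ ≤ Cc·H(h)^{ac}·(1 + τa S)^{Nc}`, (L1) a global tensor count `#(I S h) ≤ NI`, and — LOCALLY near every `z ∈ {0 < re}`, each with its own polynomial exponent —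
(L2) the archimedean Gaussian bound per pure tensor `‖Ac S i s h‖ ≤ C·H^a·(e^{−bH^{−a′}τa S}(1 + τa S)^{N₁})`, (L3) the finite-head bound per pure tensor `‖∏_v Gn S i v s h‖ ≤ C·H^a·(1 + τa S)^{N₂}`,
(L4) the transported-scalar bound `‖(∏_{v∈Pm S h} c¹_v(s)⁻¹)·G s‖ ≤ C·H^a·(1 + τa S)^{N₃}`, (L5) the shell-polynomial bound `‖∏_{v∈D S h} P S h v s‖ ≤ C·H^a·(1 + τa S)^{N₄}` — all on rank-one `S`:
THEN ★ p863404 §2's `hdec` letter holds for some GLOBAL `Na` (in fact `Na = 0`: the polynomial `(1+τ)^{Nc+N₁+N₂+N₃+N₄}` is absorbed into the Gaussian by ★ `one_add_pow_mul_exp_neg_le`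
with the height floor ★ `exists_adelicHeightGL_floor`, at the price `b ↦ b∕2`, `a ↦ a + a′·M`).
[cite: MoeglinWaldspurger1995, II.1.7, IV.1.9] [cite: Shimura1982, §3] [cite: Shimura1997, §18.4 Prop. 18.14] [cite: BorelJacquet1979, §1.2] -/
theorem hdec_of_factorBounds
    (L : Type) [Field L] [NumberField L] [IsCMField L] {n : ℕ} (e : Fin 2 × Fin 1 ≃ Fin n)
    (dV : Fin 2 → L) (hdV : ∀ i, IsCMField.complexConj L (dV i) = dV i)
    (dW : Fin 1 → L) (hdW : ∀ i, IsCMField.complexConj L (dW i) = dW i)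
    -- the data of the explicit expression (★ p863404 §2 (i)–(ii))
    (G : ℂ → ℂ) {ι ι' κ : Type*}
    (c : skewMatrices ((IsCMField.complexConj L : L ≃ₐ[Fp L] L) : L →+* L) ((gramR L e dV hdV dW hdW).map (algebraMap (Fp L) L)) → HA L e dV hdV dW hdW → ℂ)
    (D : skewMatrices ((IsCMField.complexConj L : L ≃ₐ[Fp L] L) : L →+* L) ((gramR L e dV hdV dW hdW).map (algebraMap (Fp L) L)) → HA L e dV hdV dW hdW → Finset κ)
    (P : skewMatrices ((IsCMField.complexConj L : L ≃ₐ[Fp L] L) : L →+* L) ((gramR L e dV hdV dW hdW).map (algebraMap (Fp L) L)) → HA L e dV hdV dW hdW → κ → ℂ → ℂ)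
    (Pm : skewMatrices ((IsCMField.complexConj L : L ≃ₐ[Fp L] L) : L →+* L) ((gramR L e dV hdV dW hdW).map (algebraMap (Fp L) L)) → HA L e dV hdV dW hdW → Finset (HeightOneSpectrum (𝓞 ↥(maximalRealSubfield L))))
    (I : skewMatrices ((IsCMField.complexConj L : L ≃ₐ[Fp L] L) : L →+* L) ((gramR L e dV hdV dW hdW).map (algebraMap (Fp L) L)) → HA L e dV hdV dW hdW → Finset ι')
    (T : skewMatrices ((IsCMField.complexConj L : L ≃ₐ[Fp L] L) : L →+* L) ((gramR L e dV hdV dW hdW).map (algebraMap (Fp L) L)) → HA L e dV hdV dW hdW → Finset ι)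
    (Ac : skewMatrices ((IsCMField.complexConj L : L ≃ₐ[Fp L] L) : L →+* L) ((gramR L e dV hdV dW hdW).map (algebraMap (Fp L) L)) → ι' → ℂ → HA L e dV hdV dW hdW → ℂ)
    (Gn : skewMatrices ((IsCMField.complexConj L : L ≃ₐ[Fp L] L) : L →+* L) ((gramR L e dV hdV dW hdW).map (algebraMap (Fp L) L)) → ι' → ι → ℂ → HA L e dV hdV dW hdW → ℂ)
    -- the size
    (τa : skewMatrices ((IsCMField.complexConj L : L ≃ₐ[Fp L] L) : L →+* L) ((gramR L e dV hdV dW hdW).map (algebraMap (Fp L) L)) → ℝ)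
    (hτa : ∀ S : skewMatrices ((IsCMField.complexConj L : L ≃ₐ[Fp L] L) : L →+* L) ((gramR L e dV hdV dW hdW).map (algebraMap (Fp L) L)),
      ‖(fun i j => NumberField.mixedEmbedding L ((S : Matrix (Fin n) (Fin n) L) i j))‖ ≤ τa S)
    -- (L0) the constant, GLOBAL
    {Cc ac : ℝ} (Nc : ℕ) (hCc : 0 ≤ Cc) (hac : 0 ≤ ac)
    (hcb : ∀ (S : skewMatrices ((IsCMField.complexConj L : L ≃ₐ[Fp L] L) : L →+* L) ((gramR L e dV hdV dW hdW).map (algebraMap (Fp L) L))) (h : HA L e dV hdV dW hdW), (S : Matrix (Fin n) (Fin n) L) ≠ 0 → (S : Matrix (Fin n) (Fin n) L).det = 0 →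
      ‖c S h‖ ≤ Cc * adelicHeightGL (n + n) L (h : GL (Fin (n + n)) (AdeleRing (𝓞 L) L)) ^ ac * (1 + τa S) ^ Nc)
    -- (L1) the tensor count, GLOBAL
    (NI : ℕ) (hI : ∀ (S : skewMatrices ((IsCMField.complexConj L : L ≃ₐ[Fp L] L) : L →+* L) ((gramR L e dV hdV dW hdW).map (algebraMap (Fp L) L))) (h : HA L e dV hdV dW hdW), (I S h).card ≤ NI)
    -- (L2) the ARCHIMEDEAN factor per pure tensor: Gaussian in `τa S`, polynomial exponent `N₁` local in `z`
    (hAcb : ∀ z : ℂ, 0 < z.re → ∃ (N₁ : ℕ) (C a b a' r : ℝ), 0 ≤ C ∧ 0 ≤ a ∧ 0 < b ∧ 0 ≤ a' ∧ 0 < r ∧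
      ∀ (S : skewMatrices ((IsCMField.complexConj L : L ≃ₐ[Fp L] L) : L →+* L) ((gramR L e dV hdV dW hdW).map (algebraMap (Fp L) L))) (s : ℂ), dist s z < r → ∀ h : HA L e dV hdV dW hdW, (S : Matrix (Fin n) (Fin n) L) ≠ 0 → (S : Matrix (Fin n) (Fin n) L).det = 0 → ∀ i ∈ I S h,
      ‖Ac S i s h‖ ≤ C * adelicHeightGL (n + n) L (h : GL (Fin (n + n)) (AdeleRing (𝓞 L) L)) ^ a *
        (Real.exp (-(b * adelicHeightGL (n + n) L (h : GL (Fin (n + n)) (AdeleRing (𝓞 L) L)) ^ (-a') * τa S)) * (1 + τa S) ^ N₁))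
    -- (L3) the FINITE head per pure tensor
    (hGnb : ∀ z : ℂ, 0 < z.re → ∃ (N₂ : ℕ) (C a r : ℝ), 0 ≤ C ∧ 0 ≤ a ∧ 0 < r ∧
      ∀ (S : skewMatrices ((IsCMField.complexConj L : L ≃ₐ[Fp L] L) : L →+* L) ((gramR L e dV hdV dW hdW).map (algebraMap (Fp L) L))) (s : ℂ), dist s z < r → ∀ h : HA L e dV hdV dW hdW, (S : Matrix (Fin n) (Fin n) L) ≠ 0 → (S : Matrix (Fin n) (Fin n) L).det = 0 → ∀ i ∈ I S h,
      ‖∏ v ∈ T S h, Gn S i v s h‖ ≤ C * adelicHeightGL (n + n) L (h : GL (Fin (n + n)) (AdeleRing (𝓞 L) L)) ^ a * (1 + τa S) ^ N₂)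
    -- (L4) the TRANSPORTED pole-cleared K1 scalar `(∏_{v∈Pm S h} c¹_v(s)⁻¹)·G s`
    (hGb : ∀ z : ℂ, 0 < z.re → ∃ (N₃ : ℕ) (C a r : ℝ), 0 ≤ C ∧ 0 ≤ a ∧ 0 < r ∧
      ∀ (S : skewMatrices ((IsCMField.complexConj L : L ≃ₐ[Fp L] L) : L →+* L) ((gramR L e dV hdV dW hdW).map (algebraMap (Fp L) L))) (s : ℂ), dist s z < r → ∀ h : HA L e dV hdV dW hdW, (S : Matrix (Fin n) (Fin n) L) ≠ 0 → (S : Matrix (Fin n) (Fin n) L).det = 0 →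
      ‖((∏ v ∈ Pm S h, ((1 - (v.residueCard : ℂ) ^ (-(2 * s))) / ((1 - (v.residueCard : ℂ) ^ (-(2 * s + 1))) * (1 - (quadraticHeckeCharCM L).valueAtUniformizer v * (v.residueCard : ℂ) ^ (-(2 * s + 2)))))) * G s)‖ ≤ C * adelicHeightGL (n + n) L (h : GL (Fin (n + n)) (AdeleRing (𝓞 L) L)) ^ a * (1 + τa S) ^ N₃)
    -- (L5) the SHELL POLYNOMIALS
    (hPb : ∀ z : ℂ, 0 < z.re → ∃ (N₄ : ℕ) (C a r : ℝ), 0 ≤ C ∧ 0 ≤ a ∧ 0 < r ∧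
      ∀ (S : skewMatrices ((IsCMField.complexConj L : L ≃ₐ[Fp L] L) : L →+* L) ((gramR L e dV hdV dW hdW).map (algebraMap (Fp L) L))) (s : ℂ), dist s z < r → ∀ h : HA L e dV hdV dW hdW, (S : Matrix (Fin n) (Fin n) L) ≠ 0 → (S : Matrix (Fin n) (Fin n) L).det = 0 →
      ‖∏ v ∈ D S h, P S h v s‖ ≤ C * adelicHeightGL (n + n) L (h : GL (Fin (n + n)) (AdeleRing (𝓞 L) L)) ^ a * (1 + τa S) ^ N₄) :
    ∃ Na : ℕ, ∀ z : ℂ, 0 < z.re → ∃ C a b a' r : ℝ, 0 ≤ C ∧ 0 ≤ a ∧ 0 < b ∧ 0 ≤ a' ∧ 0 < r ∧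
      ∀ (S : skewMatrices ((IsCMField.complexConj L : L ≃ₐ[Fp L] L) : L →+* L) ((gramR L e dV hdV dW hdW).map (algebraMap (Fp L) L))) (s : ℂ), dist s z < r →
      ∀ h : HA L e dV hdV dW hdW, (S : Matrix (Fin n) (Fin n) L) ≠ 0 → (S : Matrix (Fin n) (Fin n) L).det = 0 →
      ‖c S h * (∑ i ∈ I S h, Ac S i s h * ∏ v ∈ T S h, Gn S i v s h) * ((∏ v ∈ Pm S h, ((1 - (v.residueCard : ℂ) ^ (-(2 * s))) / ((1 - (v.residueCard : ℂ) ^ (-(2 * s + 1))) * (1 - (quadraticHeckeCharCM L).valueAtUniformizer v * (v.residueCard : ℂ) ^ (-(2 * s + 2)))))) * G s) * ∏ v ∈ D S h, P S h v s‖ ≤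
        C * adelicHeightGL (n + n) L (h : GL (Fin (n + n)) (AdeleRing (𝓞 L) L)) ^ a *
          (Real.exp (-(b * adelicHeightGL (n + n) L (h : GL (Fin (n + n)) (AdeleRing (𝓞 L) L)) ^ (-a') * τa S)) * (1 + τa S) ^ Na) := by
  -- `n = 2`: the height lives on `GL_{n+n}(𝔸_L)` with `n + n ≠ 0` (positivity ∕ floor of the adelic height)
  have hn : n = 2 := by simpa using (Fintype.card_congr e).symm
  haveI : NeZero (n + n) := ⟨by omega⟩
  obtain ⟨c₀, hc₀, hfloor⟩ := exists_adelicHeightGL_floor L (n + n)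
  refine ⟨0, fun z hz => ?_⟩
  obtain ⟨N₁, C₁, a₁, b, a', r₁, hC₁, ha₁, hb, ha', hr₁, hB₁⟩ := hAcb z hz
  obtain ⟨N₂, C₂, a₂, r₂, hC₂, ha₂, hr₂, hB₂⟩ := hGnb z hz
  obtain ⟨N₃, C₃, a₃, r₃, hC₃, ha₃, hr₃, hB₃⟩ := hGb z hz
  obtain ⟨N₄, C₄, a₄, r₄, hC₄, ha₄, hr₄, hB₄⟩ := hPb z hz
  -- the total polynomial exponent and the absorption constant of ★ `one_add_pow_mul_exp_neg_le`
  set M : ℕ := Nc + N₁ + N₂ + N₃ + N₄ with hM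
  set K : ℝ := (2 : ℝ) ^ M * (c₀ ^ (-(a' * M)) + (M.factorial : ℝ) * (2 / b) ^ M) with hK
  have hK0 : 0 ≤ K := by positivity
  refine ⟨Cc * NI * C₁ * C₂ * C₃ * C₄ * K, ac + a₁ + a₂ + a₃ + a₄ + a' * M, b / 2, a', min r₁ (min r₂ (min r₃ r₄)),
    by positivity, by positivity, half_pos hb, ha', lt_min hr₁ (lt_min hr₂ (lt_min hr₃ hr₄)), fun S s hs h hS0 hSd => ?_⟩
  have hs₁ : dist s z < r₁ := lt_of_lt_of_le hs (min_le_left _ _)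
  have hs₂ : dist s z < r₂ := lt_of_lt_of_le hs ((min_le_right _ _).trans (min_le_left _ _))
  have hs₃ : dist s z < r₃ := lt_of_lt_of_le hs ((min_le_right _ _).trans ((min_le_right _ _).trans (min_le_left _ _)))
  have hs₄ : dist s z < r₄ := lt_of_lt_of_le hs ((min_le_right _ _).trans ((min_le_right _ _).trans (min_le_right _ _)))
  -- the five bounds at `(S, s, h)`, then the height and the size as opaque reals `H ≥ c₀ > 0`, `τ ≥ 0`
  have hτ0 : 0 ≤ τa S := (norm_nonneg _).trans (hτa S)
  have b0 := hcb S h hS0 hSd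
  have b1 := fun i hi => hB₁ S s hs₁ h hS0 hSd i hi
  have b2 := fun i hi => hB₂ S s hs₂ h hS0 hSd i hi
  have b3 := hB₃ S s hs₃ h hS0 hSd
  have b4 := hB₄ S s hs₄ h hS0 hSd
  have hfl := hfloor (h : GL (Fin (n + n)) (AdeleRing (𝓞 L) L))
  have hHpos : 0 < adelicHeightGL (n + n) L (h : GL (Fin (n + n)) (AdeleRing (𝓞 L) L)) := adelicHeightGL_pos_holds _
  generalize adelicHeightGL (n + n) L (h : GL (Fin (n + n)) (AdeleRing (𝓞 L) L)) = H at b0 b1 b2 b3 b4 hfl hHpos ⊢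
  generalize τa S = τ at b0 b1 b2 b3 b4 hτ0 ⊢
  have h1τ : 0 ≤ 1 + τ := by linarith
  have hE0 : 0 < Real.exp (-(b * H ^ (-a') * τ)) := Real.exp_pos _
  -- the head: a sum of `#(I S h) ≤ NI` products of an archimedean and a finite factor
  have bS : ‖(∑ i ∈ I S h, Ac S i s h * ∏ v ∈ T S h, Gn S i v s h)‖ ≤
      NI * ((C₁ * H ^ a₁ * (Real.exp (-(b * H ^ (-a') * τ)) * (1 + τ) ^ N₁)) * (C₂ * H ^ a₂ * (1 + τ) ^ N₂)) := by
    have hterm : ∀ i ∈ I S h, ‖Ac S i s h * ∏ v ∈ T S h, Gn S i v s h‖ ≤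
        (C₁ * H ^ a₁ * (Real.exp (-(b * H ^ (-a') * τ)) * (1 + τ) ^ N₁)) * (C₂ * H ^ a₂ * (1 + τ) ^ N₂) := fun i hi => by
      rw [norm_mul]
      exact mul_le_mul (b1 i hi) (b2 i hi) (norm_nonneg _) (by positivity)
    calc ‖(∑ i ∈ I S h, Ac S i s h * ∏ v ∈ T S h, Gn S i v s h)‖
        ≤ ∑ i ∈ I S h, ‖Ac S i s h * ∏ v ∈ T S h, Gn S i v s h‖ := norm_sum_le _ _
      _ ≤ ∑ i ∈ I S h, (C₁ * H ^ a₁ * (Real.exp (-(b * H ^ (-a') * τ)) * (1 + τ) ^ N₁)) * (C₂ * H ^ a₂ * (1 + τ) ^ N₂) := Finset.sum_le_sum hterm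
      _ = ((I S h).card : ℝ) * ((C₁ * H ^ a₁ * (Real.exp (-(b * H ^ (-a') * τ)) * (1 + τ) ^ N₁)) * (C₂ * H ^ a₂ * (1 + τ) ^ N₂)) := by
          rw [Finset.sum_const, nsmul_eq_mul]
      _ ≤ NI * ((C₁ * H ^ a₁ * (Real.exp (-(b * H ^ (-a') * τ)) * (1 + τ) ^ N₁)) * (C₂ * H ^ a₂ * (1 + τ) ^ N₂)) :=
          mul_le_mul_of_nonneg_right (Nat.cast_le.2 (hI S h)) (by positivity)
  -- the four factors
  have hX : ‖c S h * (∑ i ∈ I S h, Ac S i s h * ∏ v ∈ T S h, Gn S i v s h) * ((∏ v ∈ Pm S h, ((1 - (v.residueCard : ℂ) ^ (-(2 * s))) / ((1 - (v.residueCard : ℂ) ^ (-(2 * s + 1))) * (1 - (quadraticHeckeCharCM L).valueAtUniformizer v * (v.residueCard : ℂ) ^ (-(2 * s + 2)))))) * G s) * ∏ v ∈ D S h, P S h v s‖ ≤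
      (Cc * H ^ ac * (1 + τ) ^ Nc) * (NI * ((C₁ * H ^ a₁ * (Real.exp (-(b * H ^ (-a') * τ)) * (1 + τ) ^ N₁)) * (C₂ * H ^ a₂ * (1 + τ) ^ N₂))) *
        (C₃ * H ^ a₃ * (1 + τ) ^ N₃) * (C₄ * H ^ a₄ * (1 + τ) ^ N₄) := by
    rw [norm_mul, norm_mul, norm_mul]
    exact mul_le_mul (mul_le_mul (mul_le_mul b0 bS (norm_nonneg _) (by positivity)) b3 (norm_nonneg _) (by positivity)) b4 (norm_nonneg _)
      (by positivity)
  -- collect the powers of `H` and of `1 + τ`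
  have hregroup : (Cc * H ^ ac * (1 + τ) ^ Nc) * (NI * ((C₁ * H ^ a₁ * (Real.exp (-(b * H ^ (-a') * τ)) * (1 + τ) ^ N₁)) * (C₂ * H ^ a₂ * (1 + τ) ^ N₂))) *
        (C₃ * H ^ a₃ * (1 + τ) ^ N₃) * (C₄ * H ^ a₄ * (1 + τ) ^ N₄) =
      (Cc * NI * C₁ * C₂ * C₃ * C₄) * (H ^ ac * H ^ a₁ * H ^ a₂ * H ^ a₃ * H ^ a₄) * (Real.exp (-(b * H ^ (-a') * τ)) * (1 + τ) ^ M) := by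
    rw [hM]
    ring
  have hHpow : H ^ ac * H ^ a₁ * H ^ a₂ * H ^ a₃ * H ^ a₄ = H ^ (ac + a₁ + a₂ + a₃ + a₄) := by
    rw [Real.rpow_add hHpos, Real.rpow_add hHpos, Real.rpow_add hHpos, Real.rpow_add hHpos]
  -- absorb `(1 + τ)^M` into the Gaussian (★ `one_add_pow_mul_exp_neg_le`, height floor `c₀ ≤ H`)
  have habs := one_add_pow_mul_exp_neg_le (H := H) (τ := τ) hb hc₀ hfl ha' hτ0 M
  calc ‖c S h * (∑ i ∈ I S h, Ac S i s h * ∏ v ∈ T S h, Gn S i v s h) * ((∏ v ∈ Pm S h, ((1 - (v.residueCard : ℂ) ^ (-(2 * s))) / ((1 - (v.residueCard : ℂ) ^ (-(2 * s + 1))) * (1 - (quadraticHeckeCharCM L).valueAtUniformizer v * (v.residueCard : ℂ) ^ (-(2 * s + 2)))))) * G s) * ∏ v ∈ D S h, P S h v s‖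
      ≤ (Cc * H ^ ac * (1 + τ) ^ Nc) * (NI * ((C₁ * H ^ a₁ * (Real.exp (-(b * H ^ (-a') * τ)) * (1 + τ) ^ N₁)) * (C₂ * H ^ a₂ * (1 + τ) ^ N₂))) *
          (C₃ * H ^ a₃ * (1 + τ) ^ N₃) * (C₄ * H ^ a₄ * (1 + τ) ^ N₄) := hX
    _ = (Cc * NI * C₁ * C₂ * C₃ * C₄) * H ^ (ac + a₁ + a₂ + a₃ + a₄) * (Real.exp (-(b * H ^ (-a') * τ)) * (1 + τ) ^ M) := by rw [hregroup, hHpow]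
    _ ≤ (Cc * NI * C₁ * C₂ * C₃ * C₄) * H ^ (ac + a₁ + a₂ + a₃ + a₄) * (K * H ^ (a' * M) * Real.exp (-(b / 2 * H ^ (-a') * τ))) :=
        mul_le_mul_of_nonneg_left habs (by positivity)
    _ = (Cc * NI * C₁ * C₂ * C₃ * C₄ * K) * (H ^ (ac + a₁ + a₂ + a₃ + a₄) * H ^ (a' * M)) * (Real.exp (-(b / 2 * H ^ (-a') * τ)) * (1 + τ) ^ 0) := by
        rw [pow_zero, mul_one]
        ring
    _ = (Cc * NI * C₁ * C₂ * C₃ * C₄ * K) * H ^ (ac + a₁ + a₂ + a₃ + a₄ + a' * M) * (Real.exp (-(b / 2 * H ^ (-a') * τ)) * (1 + τ) ^ 0) := by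
        rw [← Real.rpow_add hHpos]

end Summit.HodgeConjecture.HodgeConjecture.Cruxes.HLiu418.K2LiuKindOneSingularDecayOfLetters

end
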